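import Summits.ResolutionOfSingularities.ResolutionOfSingularities.Theorems.DescentDescentPerfectToAllResidualWitness
import HarnessLib

/-!
# `DescentPerfectToAll` (stmt-ResolutionOfSingularities-0549): the residual criterion in general `p`-rank

Route `ResolutionOfSingularities/Descent`, crux `DescentPerfectToAll`. Helper (OURS; not a statement of any
manuscript; `--supports` the crux, does not close it).

`not_exhaustedByEssFiniteType_of_pRank_le_one` (`DescentDescentPerfectToAllResidualWitness.lean`) is the
`p`-rank-one case of the following «`p`-RANK DEFECT» criterion, recorded here because it is the shape of the
residual class of the crux (`descentPerfectToAll_iff_residual`) on the side of fields whose perfect subfields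
are trivial: the coverage theorems reach the fields with `p`-rank `=` transcendence degree
(`descentPerfectToAll_finitePBasis`, `hasResolution_of_perfectRes_of_exhaustedByEssFiniteType`), and NO field
with `p`-rank `<` transcendence degree.

* `not_exhaustedByEssFiniteType_of_pRank_le` — a field `K` of characteristic `p` with (a) every finite
  `K^p`-linearly independent family of at most `p^r` members (`[K : K^p] ≤ p^r`, `p`-rank `≤ r`), (b) only
  the prime field as image of perfect fields, (c) an algebraically independent family of `r + 1` elements,
  is NOT EFT-separably exhausted (same proof as the rank-one case: `[E : E^p] = p^{tr.deg E} ≥ p^{r+1}` for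
  the relevant `E`, and Mac Lane symmetry).

[cite: Matsumura1987, Thm. 26.4 and Thm. 26.5; EGAIV2, Prop. 6.7.4] [folklore]
-/

noncomputable section

set_option linter.dupNamespace false -- mandated namespace of this single-conjunct summit

namespace Summit.ResolutionOfSingularities.ResolutionOfSingularities.Theorems

variable (p : ℕ) [Fact p.Prime]

/-- **`p`-rank defect ⇒ not EFT-separably exhausted.** Let `K` have characteristic `p` and suppose:
(a) every finite `K^p`-linearly independent family in `K` has at most `p^r` members; (b) every ring map from
a perfect field into `K` takes values in the prime field; (c) `K` contains an algebraically independent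
family over `ℤ/p` with at least `r + 1` members. Then `K` is not EFT-separably exhausted: for a perfect `k₀`
and `E ≤ K` essentially of finite type over `k₀` containing the family, `[E : E^p] = p^{tr.deg_{k₀} E} ≥ p^{r+1}`
(Matsumura Thm. 26.5, tree `exists_finrank_frobenius_eq_pow_card`; `tr.deg ≥ r + 1` because the image of
`k₀` is the prime field), and Mac Lane symmetry (`linearIndependent_frobenius_of_macLane`) would move an
`E^p`-basis of `E` to a `K^p`-linearly independent family of more than `p^r` members.
[cite: Matsumura1987, Thm. 26.4 and Thm. 26.5; EGAIV2, Prop. 6.7.4] -/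
theorem not_exhaustedByEssFiniteType_of_pRank_le (r : ℕ) (K : Type) [Field K] [CharP K p]
    [Algebra (ZMod p) K]
    (hrank : ∀ (n : ℕ) (v : Fin n → K), LinearIndependent (frobenius K p).fieldRange v → n ≤ p ^ r)
    (hperf : ∀ (k₀ : Type) [Field k₀] [PerfectField k₀] (φ : k₀ →+* K) (a : k₀),
      ∃ c : ZMod p, φ a = algebraMap (ZMod p) K c)
    {ι : Type} [Fintype ι] (x : ι → K) (hx : AlgebraicIndependent (ZMod p) x)
    (hr : r + 1 ≤ Fintype.card ι) :
    ¬ ∀ s : Finset K, ∃ (k₀ : Type) (_ : Field k₀) (_ : PerfectField k₀)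
      (E : Subfield K) (_ : Algebra k₀ E), Algebra.EssFiniteType k₀ E ∧ (↑s : Set K) ⊆ E ∧
        ∀ u : Finset K, LinearIndepOn E _root_.id (↑u : Set K) →
          LinearIndepOn E (fun y : K => y ^ p) (↑u : Set K) := by
  classical
  intro hk
  have hp : p.Prime := Fact.out
  obtain ⟨k₀, hF, hP, E, hA, hEFT, hsub, hML⟩ := hk (Finset.univ.image x)
  haveI : CharP E p := E.subtype.charP Subtype.val_injective p
  have hxE : ∀ i, x i ∈ E := fun i => hsub (by simp)
  have hφ : ∀ a : k₀, ∃ c : ZMod p, E.subtype (algebraMap k₀ E a) = algebraMap (ZMod p) K c :=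
    fun a => hperf k₀ (E.subtype.comp (algebraMap k₀ E)) a
  haveI : CharP k₀ p := (E.subtype.comp (algebraMap k₀ E)).charP
    (E.subtype.comp (algebraMap k₀ E)).injective p
  set xE : ι → E := fun i => ⟨x i, hxE i⟩ with hxEdef
  have hindE : AlgebraicIndependent k₀ xE :=
    algebraicIndependent_of_ringHom_eq p E.subtype hφ xE hx
  obtain ⟨t, ht, -, -, hfin⟩ :=
    Literature.FieldTheory.Separability.exists_finrank_frobenius_eq_pow_card (k := k₀) (K := E) p
  have hrt : r + 1 ≤ t.card := by
    have h1 := hindE.cardinalMk_le_trdeg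
    rw [← ht.cardinalMk_eq_trdeg, Cardinal.mk_coe_finset, Cardinal.mk_fintype] at h1
    norm_cast at h1
    exact hr.trans h1
  haveI : Module.Finite (frobenius E p).fieldRange E :=
    Module.finite_of_finrank_pos (by rw [hfin]; exact pow_pos hp.pos _)
  let b := Module.finBasis (frobenius E p).fieldRange E
  have hbK := linearIndependent_frobenius_of_macLane p E hML b b.linearIndependent
  have hcard := hrank _ _ hbK
  rw [hfin] at hcard
  have h3 : p ^ (r + 1) ≤ p ^ t.card := Nat.pow_le_pow_right hp.pos hrt
  have h4 : p ^ r < p ^ (r + 1) := Nat.pow_lt_pow_right hp.one_lt (Nat.lt_succ_self r)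
  exact absurd (h3.trans hcard) (not_le.mpr h4)

end Summit.ResolutionOfSingularities.ResolutionOfSingularities.Theorems

end
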